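import Mathlib
import Summits.MatrixMultiplication.MatrixMultiplication.Theses.FidelityWitnesses
import Summits.MatrixMultiplication.MatrixMultiplication.Theorems.FidelityWitnessesFidelityGapTwoSix
import Literature.Computability.AlgebraicComplexity.AsymptoticRankZariskiClosedProofs

/-!
# `FidelityWitnesses.SevenEighthsLaw` ⟺ the unit ball around `⟨2,2,2⟩` contains no tensor of rank `≤ 6`

Support file for crux item `stmt-MatrixMultiplication-4959`
(`Summit.MatrixMultiplication.MatrixMultiplication.Theses.FidelityWitnesses.SevenEighthsLaw`, `M(2,6) = 7`).

The crux is stated as a correlation bound, `|Σ S·⟨2,2,2⟩|² ≤ 7 · Σ|S|²` for every `S` of tensor rank `≤ 6`.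
Because the rank-`≤ 6` tensors form a complex CONE (`tensorRank_smul_le`), this is the same as a DISTANCE
statement: `Σ |⟨2,2,2⟩ − S|² ≥ 1` for every `S` of rank `≤ 6`, i.e. every tensor at Frobenius distance `< 1`
from `⟨2,2,2⟩` has rank `≥ 7` (`‖⟨2,2,2⟩‖² = 8`; equality `Σ|T − S|² = 1` at `S = ⟨2,2,2⟩` minus one unit
triad, `Cruxes/SevenEighthsLaw/Disproof.lean`, `sixS`).  So `SevenEighthsLaw` reads: the distance from `⟨2,2,2⟩`
to the sixth secant cone is EXACTLY `1` — a quantitative form of `R̲(⟨2,2,2⟩) = 7` (which is the statement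
that this distance is positive; `Landsberg2005_borderRank_matMulTensor_two_holds`).

* `sevenEighthsLaw_dist_sq_expand` — `Σ|T − S|² = 8 + Σ|S|² − 2 Re Σ S·T` (`T = ⟨2,2,2⟩` is real).
* `sevenEighthsLaw_iff_unitBall` — the equivalence.
-/

set_option linter.dupNamespace false

namespace Summit.MatrixMultiplication.MatrixMultiplication.Theorems.SevenEighthsLaw

open scoped BigOperators ComplexConjugate
open Literature.Computability.AlgebraicComplexity
open Summit.MatrixMultiplication.MatrixMultiplication.Theses.FidelityWitnesses

/-- Polarisation against the real tensor `T = ⟨2,2,2⟩`: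
`Σ |T − S|² = 8 + Σ |S|² − 2 · Re Σ S·T`. -/
theorem sevenEighthsLaw_dist_sq_expand (S : (Fin 2 × Fin 2) → (Fin 2 × Fin 2) → (Fin 2 × Fin 2) → ℂ) :
    (∑ a, ∑ b, ∑ c, ‖matMulTensor ℂ 2 2 2 a b c - S a b c‖ ^ 2) =
      8 + (∑ a, ∑ b, ∑ c, ‖S a b c‖ ^ 2) -
        2 * (∑ a, ∑ b, ∑ c, S a b c * matMulTensor ℂ 2 2 2 a b c).re := by
  have h1 : ∀ a b c : Fin 2 × Fin 2, ‖matMulTensor ℂ 2 2 2 a b c - S a b c‖ ^ 2 =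
      ‖matMulTensor ℂ 2 2 2 a b c‖ ^ 2 + ‖S a b c‖ ^ 2 -
        2 * (S a b c * matMulTensor ℂ 2 2 2 a b c).re := by
    intro a b c
    rw [Complex.sq_norm, Complex.sq_norm, Complex.sq_norm, Complex.normSq_sub]
    have hre : (matMulTensor ℂ 2 2 2 a b c * conj (S a b c)).re =
        (S a b c * matMulTensor ℂ 2 2 2 a b c).re := by
      rw [← Complex.conj_re (matMulTensor ℂ 2 2 2 a b c * conj (S a b c)), map_mul,
        Complex.conj_conj, fidelityGapTwoSix_conj_matMulTensor_two, mul_comm]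
    rw [hre]
  simp_rw [h1, Finset.sum_sub_distrib, Finset.sum_add_distrib, ← Finset.mul_sum, Complex.re_sum,
    fidelityGapTwoSix_normSq_matMulTensor_two]

/-- **`SevenEighthsLaw` ⟺ every tensor of rank `≤ 6` lies at Frobenius distance `≥ 1` from `⟨2,2,2⟩`**
(the open unit ball around `⟨2,2,2⟩` contains only tensors of rank `≥ 7`; `dist(⟨2,2,2⟩, σ₆)² = 1`).
`⇒`: `Σ|T−S|² = 8 + ‖S‖² − 2 Re⟨S,T⟩ ≥ 8 + ‖S‖² − 2√7 ‖S‖ = (‖S‖ − √7)² + 1`.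
`⇐`: the rank-`≤ 6` tensors are closed under scalars, and `Σ|T − λS|² ≥ 1` at `λ = conj(Σ S·T)/‖S‖²` is
`8 − |Σ S·T|²/‖S‖² ≥ 1`. -/
theorem sevenEighthsLaw_iff_unitBall :
    SevenEighthsLaw ↔
      ∀ S : (Fin 2 × Fin 2) → (Fin 2 × Fin 2) → (Fin 2 × Fin 2) → ℂ, tensorRank S ≤ 6 →
        1 ≤ ∑ a, ∑ b, ∑ c, ‖matMulTensor ℂ 2 2 2 a b c - S a b c‖ ^ 2 := by
  constructor
  · intro h S hS
    have hB := h S hS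
    rw [sevenEighthsLaw_dist_sq_expand]
    set N : ℝ := ∑ a, ∑ b, ∑ c, ‖S a b c‖ ^ 2 with hN
    set B : ℂ := ∑ a, ∑ b, ∑ c, S a b c * matMulTensor ℂ 2 2 2 a b c with hBdef
    have hre : B.re ≤ ‖B‖ := Complex.re_le_norm B
    have hN0 : 0 ≤ N := by positivity
    have hb0 : 0 ≤ ‖B‖ := norm_nonneg B
    nlinarith [hB, hre, hb0, hN0, sq_nonneg (N - 7), sq_nonneg (2 * ‖B‖ - (7 + N))]
  · intro h S hS
    set N : ℝ := ∑ a, ∑ b, ∑ c, ‖S a b c‖ ^ 2 with hN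
    set B : ℂ := ∑ a, ∑ b, ∑ c, S a b c * matMulTensor ℂ 2 2 2 a b c with hBdef
    have hN0 : 0 ≤ N := by positivity
    rcases hN0.lt_or_eq with hNpos | hN00
    · -- test the ball condition on `λ • S`, `λ = conj B / N`
      set lam : ℂ := conj B / (N : ℂ) with hlam
      have key := h (lam • S) ((tensorRank_smul_le lam S).trans hS)
      rw [sevenEighthsLaw_dist_sq_expand] at key
      have hNl : (∑ a, ∑ b, ∑ c, ‖(lam • S) a b c‖ ^ 2) = ‖lam‖ ^ 2 * N := by
        simp only [Pi.smul_apply, smul_eq_mul, norm_mul, mul_pow, hN, Finset.mul_sum]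
      have hBl : (∑ a, ∑ b, ∑ c, (lam • S) a b c * matMulTensor ℂ 2 2 2 a b c) = lam * B := by
        simp only [Pi.smul_apply, smul_eq_mul, hBdef, Finset.mul_sum, mul_assoc]
      rw [hNl, hBl] at key
      have h1 : ‖lam‖ ^ 2 * N = ‖B‖ ^ 2 / N := by
        rw [hlam, norm_div, Complex.norm_conj, Complex.norm_real, Real.norm_of_nonneg hNpos.le]
        field_simp
      have h2 : (lam * B).re = ‖B‖ ^ 2 / N := by
        have : lam * B = ((‖B‖ ^ 2 / N : ℝ) : ℂ) := by
          rw [hlam, div_mul_eq_mul_div, Complex.conj_mul']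
          push_cast
          ring
        rw [this, Complex.ofReal_re]
      rw [h1, h2] at key
      have h3 : ‖B‖ ^ 2 / N ≤ 7 := by linarith
      rwa [div_le_iff₀ hNpos] at h3
    · -- `S = 0`
      have hS0 : ∀ a b c, S a b c = 0 := by
        intro a b c
        have hsum : (∑ a, ∑ b, ∑ c, ‖S a b c‖ ^ 2) = 0 := hN00.symm
        have ha := (Finset.sum_eq_zero_iff_of_nonneg fun a _ => by positivity).1 hsum a (Finset.mem_univ a)
        have hb := (Finset.sum_eq_zero_iff_of_nonneg fun b _ => by positivity).1 ha b (Finset.mem_univ b)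
        have hc := (Finset.sum_eq_zero_iff_of_nonneg fun c _ => by positivity).1 hb c (Finset.mem_univ c)
        simpa using hc
      have hB0 : B = 0 := by
        rw [hBdef]
        exact Finset.sum_eq_zero fun a _ => Finset.sum_eq_zero fun b _ =>
          Finset.sum_eq_zero fun c _ => by rw [hS0 a b c, zero_mul]
      rw [hB0, ← hN00]
      simp

end Summit.MatrixMultiplication.MatrixMultiplication.Theorems.SevenEighthsLaw
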